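import Summits.HubbardSuperconductivity.HubbardSuperconductivity.Theorems.DeformationLadderLadderThesisPinnedFrameCovariance
import Summits.HubbardSuperconductivity.HubbardSuperconductivity.Theorems.DeformationLadderLadderThesisNormalForms
import Literature.MathematicalPhysics.QuantumLattice.FinDimSpectrumSectorGibbsLimit
import HarnessLib

/-!
# Pinned spin-↑ gauge frame for `LadderThesis` (stmt-HubbardSuperconductivity-1890) — the frames
# as Lieb–Schultz–Mattis twists, isospectral frames, frame pinning ⇒ `LadderThesis`

* `upTwistAngle_single`, `frameHamiltonian_eq`, `frameHamiltonian_add_frameHamiltonian_neg`,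
  `re_expect_lsmPerturbation_single_le` — the axis frames are the Lieb–Schultz–Mattis twists: the
  frame Hamiltonian `D_k⁻¹ H D_k` is a Peierls–Hubbard Hamiltonian in a flat spin-↑ connection, the
  two opposite frames average to `H + P_θ` (`P_θ = lsmPerturbation`, Bloch's one-body twist
  functional), and `P_{θ_{eᵢ}}` costs `≤ 16π²`.
* `minEnergyOn_eq_of_unitary_transport` — instance-free transport of sector energies by a unitary
  (vector unitarity + sector stability + equality of quadratic forms);
  `minEnergyOn_le_minEnergyOn_add_penalty` — a positive penalty cannot lower a sector energy.
* `minEnergyOn_penalisedAt_eq` (**TwistIsospectral**): `H + c•Δ↑_d(k)ᴴΔ↑_d(k)` and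
  `D_k⁻¹ H D_k + c•Δ_dᴴΔ_d` have equal sector energies (`fockTwist` preserves every `szSector N M`).
* `ladderThesis_of_framePinning` (**FramePinningImpliesLadder**, by name): if the zero frame costs
  `≥ a·s` more than every other single-mode frame, the route's crux `LadderThesis` holds
  (every frame is `≥ E₀`, then the route's `ladderThesis_of_penaltyGap`).

References: Lieb–Schultz–Mattis (1961) App. B; Bohm, Phys. Rev. 75 (1949) 502; Tada–Koma, J. Stat.
Phys. 165 (2016) 455, §2; Kaplan–Horsch–von der Linden, J. Phys. Soc. Jpn. 58 (1989) 3894;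
Tasaki (2020) §2.1–2.2; Fulde–Ferrell (1964).
-/

noncomputable section

namespace Summit.HubbardSuperconductivity.HubbardSuperconductivity.Theorems.PinnedFrame

set_option linter.dupNamespace false

open Matrix Finset Complex Literature.MathematicalPhysics.QuantumLattice
  Literature.Probability.LatticeModels HubbardWave0
open scoped ComplexOrder ComplexConjugate Matrix.Norms.L2Operator

variable (L : ℕ) [NeZero L]

/-! ### The frames along the axes are the Lieb–Schultz–Mattis twists -/

omit [NeZero L] in
/-- **`θ_{eᵢ} = lsmTwist L i 0`**: the flat spin-↑ frame of winding `eᵢ` is the tree's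
Lieb–Schultz–Mattis twist of the spin-↑ species along the `i`-th cycle (`L ≥ 2`).
Lieb–Schultz–Mattis (1961), App. B; Yamanaka–Oshikawa–Affleck, PRL 79 (1997) 1110. [folklore] -/
theorem upTwistAngle_single (hL : 2 ≤ L) (i : Fin 2) :
    upTwistAngle L (Pi.single i 1) = lsmTwist L i 0 := by
  haveI : Fact (1 < L) := ⟨hL⟩
  funext o
  unfold upTwistAngle
  rw [lsmTwist_apply]
  split_ifs with h
  · rw [Fin.sum_univ_two]
    fin_cases i <;> simp [latticeMomentum, ZMod.val_one]
  · rfl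

omit [NeZero L] in
/-- **The frame Hamiltonian is a Peierls–Hubbard Hamiltonian in a FLAT spin-↑ connection**:
`D_k⁻¹ H D_k = -T(e^{i(θ_k(v,σ) - θ_k(u,σ))}) + U Σ n↑n↓`, the hopping of the spin-↑ species
acquiring the pure-gauge phases `e^{i(θ_k(v) - θ_k(u))}` (`fockTwist_mul_hamiltonianWith_mul`).
Lieb–Schultz–Mattis (1961), App. B; Yamanaka–Oshikawa–Affleck (1997). [folklore] -/
theorem frameHamiltonian_eq (U : ℝ) (k : TorusSite 2 L) :
    fockTwist (-upTwistAngle L k) * hubbardTorus 2 L 1 U * fockTwist (upTwistAngle L k) =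
      -spinHop (fermionTorusGraph 2 L) (fun u v σ =>
          cexp (((upTwistAngle L k (orb v σ) - upTwistAngle L k (orb u σ) : ℝ) : ℂ) * I)) +
        densityTerms U 0 := by
  have h := fockTwist_mul_hamiltonianWith_mul (fermionTorusGraph 2 L) (-upTwistAngle L k) 1 U 0
  rw [neg_neg] at h
  have e : hamiltonianWith (fermionTorusGraph 2 L) 1 U 0 = hubbardTorus 2 L 1 U :=
    hubbardTorusWith_zero 2 L 1 U
  rw [← e, h, Complex.ofReal_one, neg_one_smul]
  have hf : (fun (u v : FermionTorus 2 L) (σ : Fin 2) =>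
      cexp ((((-upTwistAngle L k) (orb u σ) - (-upTwistAngle L k) (orb v σ) : ℝ) : ℂ) * I)) =
      fun u v σ => cexp (((upTwistAngle L k (orb v σ) - upTwistAngle L k (orb u σ) : ℝ) : ℂ) * I) := by
    funext u v σ
    simp only [Pi.neg_apply, neg_sub_neg]
  rw [hf]

omit [NeZero L] in
/-- **The Lieb–Schultz–Mattis identity for the frames**: the two oppositely boosted Hamiltonians
average to `H` plus the one-body twist functional,
`D_k⁻¹ H D_k + D_k H D_k⁻¹ = 2H + 2 P_{θ_k}`, `P_θ = -T(cos(θ_u - θ_v) - 1)` (the tree's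
`lsmPerturbation`); for `k = eᵢ` this is `(1 - cos(2π/L)) (-T_{i,↑})`, Bloch's/Bohm's variational
twist functional. Lieb–Schultz–Mattis (1961), App. B, eq. (B-5); Bohm (1949); Tada–Koma (2016) §2. [folklore] -/
theorem frameHamiltonian_add_frameHamiltonian_neg (U : ℝ) (k : TorusSite 2 L) :
    fockTwist (-upTwistAngle L k) * hubbardTorus 2 L 1 U * fockTwist (upTwistAngle L k) +
        fockTwist (upTwistAngle L k) * hubbardTorus 2 L 1 U * fockTwist (-upTwistAngle L k) =
      (2 : ℂ) • hubbardTorus 2 L 1 U +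
        (2 : ℂ) • lsmPerturbation (fermionTorusGraph 2 L) (upTwistAngle L k) 1 := by
  have h := fockTwist_conj_hamiltonianWith_add (fermionTorusGraph 2 L) (upTwistAngle L k) 1 U 0
  have e : hamiltonianWith (fermionTorusGraph 2 L) 1 U 0 = hubbardTorus 2 L 1 U :=
    hubbardTorusWith_zero 2 L 1 U
  rw [e] at h
  rw [add_comm, h]

/-- **The twist functional of an axis frame costs at most `16π²`**: for every Fock vector `φ`,
`Re⟨φ, P_{θ_{eᵢ}} φ⟩ ≤ 16π² ‖φ‖²` (`|cos(2π/L) - 1| ≤ 2π²/L²` on each of the `2L²` spin-↑ bonds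
along `eᵢ`; the tree's `re_expect_lsmPerturbation_lsmTwist_le` at `d = 2`, `t = 1`).
Lieb–Schultz–Mattis (1961), App. B. [folklore] -/
theorem re_expect_lsmPerturbation_single_le (hL : 2 ≤ L) (i : Fin 2)
    (φ : Fock (Orb (FermionTorus 2 L))) :
    (star φ ⬝ᵥ lsmPerturbation (fermionTorusGraph 2 L) (upTwistAngle L (Pi.single i 1)) 1 *ᵥ φ).re ≤
      16 * Real.pi ^ 2 * (star φ ⬝ᵥ φ).re := by
  rw [upTwistAngle_single L hL i]
  have hL' : (L : ℝ) ≠ 0 := by exact_mod_cast NeZero.ne L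
  have h := re_expect_lsmPerturbation_lsmTwist_le (d := 2) (L := L) i 0 1 φ
  have hc : 8 * Real.pi ^ 2 * (2 : ℕ) * |(1 : ℝ)| * (L : ℝ) ^ 2 / (L : ℝ) ^ 2 = 16 * Real.pi ^ 2 := by
    rw [abs_one, mul_one, mul_div_assoc, div_self (pow_ne_zero 2 hL'), mul_one]
    push_cast
    ring
  rwa [hc] at h

/-! ### Sector energies: transport by a unitary, monotonicity under positive penalties -/

section MinEnergy

variable {m : Type*} [Fintype m]

omit [NeZero L] in
/-- `⟨M v, w⟩ = ⟨v, Mᴴ w⟩` in the `dotProduct` language. [folklore] -/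
theorem star_mulVec_dotProduct (M : Matrix m m ℂ) (v w : m → ℂ) :
    star (M *ᵥ v) ⬝ᵥ w = star v ⬝ᵥ (Mᴴ *ᵥ w) := by
  rw [star_mulVec, ← dotProduct_mulVec]

omit [NeZero L] in
/-- **Transport of sector energies by a unitary** (instance-free form: `W` is unitary in the
vector sense `Wᴴ(Wv) = v = W(Wᴴv)`, and `K` is stable under `W` and `Wᴴ`). If the quadratic form
of `A` on `W`-images is the quadratic form of `B`, `⟨Wψ, A Wψ⟩ = ⟨ψ, B ψ⟩`, then `A` and `B` have
the same lowest variational energy on `K`. Tasaki (2020) §2.2. [folklore] -/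
theorem minEnergyOn_eq_of_unitary_transport (A B W : Matrix m m ℂ) (K : Submodule ℂ (m → ℂ))
    (hWW : ∀ v, Wᴴ *ᵥ (W *ᵥ v) = v) (hWW' : ∀ v, W *ᵥ (Wᴴ *ᵥ v) = v)
    (hK : ∀ ψ ∈ K, W *ᵥ ψ ∈ K) (hK' : ∀ ψ ∈ K, Wᴴ *ᵥ ψ ∈ K)
    (hAB : ∀ ψ, star (W *ᵥ ψ) ⬝ᵥ (A *ᵥ (W *ᵥ ψ)) = star ψ ⬝ᵥ (B *ᵥ ψ)) :
    A.minEnergyOn K = B.minEnergyOn K := by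
  unfold Matrix.minEnergyOn
  refine congrArg sInf (Set.Subset.antisymm ?_ ?_)
  · rintro E ⟨φ, hφ, hn, rfl⟩
    refine ⟨Wᴴ *ᵥ φ, hK' φ hφ, ?_, ?_⟩
    · rw [star_mulVec_dotProduct, conjTranspose_conjTranspose, hWW', hn]
    · rw [← hAB, hWW']
  · rintro E ⟨ψ, hψ, hn, rfl⟩
    refine ⟨W *ᵥ ψ, hK ψ hψ, ?_, ?_⟩
    · rw [star_mulVec_dotProduct, hWW, hn]
    · rw [hAB]

omit [NeZero L] in
/-- **A positive penalty cannot lower a sector energy.** For Hermitian `H`, any `B` and `c ≥ 0`,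
`minEnergyOn H K ≤ minEnergyOn (H + c • BᴴB) K` (every Rayleigh quotient of the penalised matrix
exceeds that of `H` by `c‖Bψ‖² ≥ 0`; if the sector contains no unit vector both sides are the junk
value `0`). Kaplan–Horsch–von der Linden, J. Phys. Soc. Jpn. 58 (1989) 3894; Tasaki (2020) §2.1. [folklore] -/
theorem minEnergyOn_le_minEnergyOn_add_penalty [DecidableEq m] {H : Matrix m m ℂ} (hH : H.IsHermitian)
    (B : Matrix m m ℂ) {c : ℝ} (hc : 0 ≤ c) (K : Submodule ℂ (m → ℂ)) :
    H.minEnergyOn K ≤ (H + (c : ℂ) • (Bᴴ * B)).minEnergyOn K := by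
  by_cases hK : ∃ ψ ∈ K, star ψ ⬝ᵥ ψ = (1 : ℂ)
  · obtain ⟨ψ₀, hψ₀, h1⟩ := hK
    refine le_csInf ⟨_, ψ₀, hψ₀, h1, rfl⟩ ?_
    rintro E ⟨ψ, hψ, hn, rfl⟩
    refine (minEnergyOn_le_rayleigh_of_mem hH K hψ hn).trans ?_
    rw [add_mulVec, dotProduct_add, Complex.add_re, smul_mulVec, dotProduct_smul, smul_eq_mul,
      ← Literature.MathematicalPhysics.QuantumLattice.star_mulVec_dotProduct_mulVec, Complex.re_ofReal_mul]
    have h0 : 0 ≤ (star (B *ᵥ ψ) ⬝ᵥ (B *ᵥ ψ)).re :=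
      (Complex.nonneg_iff.1 (dotProduct_star_self_nonneg _)).1
    nlinarith [mul_nonneg hc h0]
  · have hempty : ∀ A : Matrix m m ℂ,
        {E : ℝ | ∃ ψ ∈ K, star ψ ⬝ᵥ ψ = 1 ∧ E = (star ψ ⬝ᵥ A *ᵥ ψ).re} = ∅ := fun A =>
      Set.eq_empty_of_forall_notMem fun E ⟨ψ, hψ, hn, _⟩ => hK ⟨ψ, hψ, hn⟩
    simp only [Matrix.minEnergyOn, hempty, le_refl]

omit [NeZero L] in
/-- `H + c • BᴴB` is Hermitian for Hermitian `H` and real `c`. [folklore] -/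
theorem isHermitian_add_real_smul_penalty {H : Matrix m m ℂ}
    (hH : H.IsHermitian) (c : ℝ) (B : Matrix m m ℂ) : (H + (c : ℂ) • (Bᴴ * B)).IsHermitian := by
  unfold Matrix.IsHermitian
  rw [conjTranspose_add, conjTranspose_smul, conjTranspose_mul, conjTranspose_conjTranspose, hH.eq,
    Complex.star_def, Complex.conj_ofReal]

end MinEnergy

/-! ### The twist preserves the sectors; isospectrality of the momentum frames -/

omit [NeZero L] in
/-- A `U(1)` twist `fockTwist θ` (diagonal in the occupation-number basis) maps every joint sector
`(N, S^z = M)` into itself. [folklore] -/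
theorem fockTwist_mulVec_mem_szSector {Λ : Type*} [LinearOrder Λ] [Fintype Λ] (θ : Orb Λ → ℝ)
    {N : ℕ} {M : ℝ} {ψ : Fock (Orb Λ)} (h : ψ ∈ szSector N M) :
    fockTwist θ *ᵥ ψ ∈ szSector N M := by
  rw [mem_szSector_iff] at h ⊢
  obtain ⟨hN, hZ⟩ := h
  refine ⟨fun s hs => by rw [fockTwist_mulVec_apply, hN s hs, mul_zero], ?_⟩
  funext s
  have hs := congrFun hZ s
  rw [LiebThm1.spinZ_mulVec_apply, Pi.smul_apply, smul_eq_mul] at hs ⊢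
  rw [fockTwist_mulVec_apply, mul_left_comm, hs, mul_left_comm]

omit [NeZero L] in
/-- Vector unitarity of the twist, `D_k (D_k⁻¹ w) = w` (instance-free). [folklore] -/
theorem fockTwist_mulVec_fockTwist_neg_mulVec (θ : Orb (FermionTorus 2 L) → ℝ)
    (w : Fock (Orb (FermionTorus 2 L))) : fockTwist θ *ᵥ (fockTwist (-θ) *ᵥ w) = w := by
  have h := fockTwist_mulVec_conjTranspose_mulVec θ w
  rwa [conjTranspose_fockTwist] at h

omit [NeZero L] in
/-- Vector unitarity of the twist, `D_k⁻¹ (D_k w) = w` (instance-free). [folklore] -/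
theorem fockTwist_neg_mulVec_fockTwist_mulVec (θ : Orb (FermionTorus 2 L) → ℝ)
    (w : Fock (Orb (FermionTorus 2 L))) : fockTwist (-θ) *ᵥ (fockTwist θ *ᵥ w) = w := by
  have h := conjTranspose_fockTwist_mulVec_mulVec θ w
  rwa [conjTranspose_fockTwist] at h

/-- The quadratic form of the frame matrix `D_k⁻¹ H D_k + c • Δ_dᴴΔ_d` on the boosted vector
`D_k⁻¹ψ` is the quadratic form of `H + c • Δ↑_d(k)ᴴΔ↑_d(k)` on `ψ` (covariance of the penalty and
unitarity of the boost, read on vectors — no operator identity `D D⁻¹ = 1` is used, so that no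
`DecidableEq` instance enters). [folklore] -/
theorem form_frame_boost (U : ℝ) (c : ℂ) (k : TorusSite 2 L) (ψ : Fock (Orb (FermionTorus 2 L))) :
    star (fockTwist (-upTwistAngle L k) *ᵥ ψ) ⬝ᵥ
        ((fockTwist (-upTwistAngle L k) * hubbardTorus 2 L 1 U * fockTwist (upTwistAngle L k) +
          c • ((pairField dWaveFormFactor L)ᴴ * pairField dWaveFormFactor L)) *ᵥ
          (fockTwist (-upTwistAngle L k) *ᵥ ψ)) =
      star ψ ⬝ᵥ ((hubbardTorus 2 L 1 U + c • ((upPairFieldAt dWaveFormFactor L k)ᴴ *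
          upPairFieldAt dWaveFormFactor L k)) *ᵥ ψ) := by
  set θ := upTwistAngle L k with hθ
  rw [star_mulVec_dotProduct, conjTranspose_fockTwist, neg_neg]
  refine congrArg (star ψ ⬝ᵥ ·) ?_
  rw [add_mulVec, mulVec_add, smul_mulVec, mulVec_smul, ← mulVec_mulVec, ← mulVec_mulVec,
    fockTwist_mulVec_fockTwist_neg_mulVec, fockTwist_mulVec_fockTwist_neg_mulVec, mulVec_mulVec,
    mulVec_mulVec, hθ, fockTwist_conj_pairPenalty_dWave, add_mulVec, smul_mulVec]

/-- **Isospectrality of the momentum frames (`TwistIsospectral`).** For every coefficient `c`,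
winding `k` and sector `(N, M)`: the Hubbard torus penalised at pair momentum `k`,
`H + c • Δ↑_d(k)ᴴΔ↑_d(k)`, has the same sector energy as "`H` in the `k`-th flat spin-↑ frame,
penalised at the zero mode", `D_k⁻¹ H D_k + c • Δ_dᴴΔ_d` — the two matrices are conjugate under the
sector-preserving unitary `D_k = fockTwist (upTwistAngle L k)` (covariance of the penalty).
Fulde–Ferrell (1964); Lieb–Schultz–Mattis (1961), App. B. [folklore] -/
theorem minEnergyOn_penalisedAt_eq (U : ℝ) (c : ℂ) (k : TorusSite 2 L) (N : ℕ) (M : ℝ) :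
    (hubbardTorus 2 L 1 U + c • ((upPairFieldAt dWaveFormFactor L k)ᴴ *
        upPairFieldAt dWaveFormFactor L k)).minEnergyOn (szSector N M) =
      (fockTwist (-upTwistAngle L k) * hubbardTorus 2 L 1 U * fockTwist (upTwistAngle L k) +
        c • ((pairField dWaveFormFactor L)ᴴ * pairField dWaveFormFactor L)).minEnergyOn
        (szSector N M) := by
  have hV : (fockTwist (-upTwistAngle L k))ᴴ = fockTwist (upTwistAngle L k) := by
    rw [conjTranspose_fockTwist, neg_neg]
  refine (minEnergyOn_eq_of_unitary_transport _ _ (fockTwist (-upTwistAngle L k)) _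
    (conjTranspose_fockTwist_mulVec_mulVec _) (fockTwist_mulVec_conjTranspose_mulVec _)
    (fun ψ hψ => fockTwist_mulVec_mem_szSector _ hψ)
    (fun ψ hψ => by rw [hV]; exact fockTwist_mulVec_mem_szSector _ hψ)
    (form_frame_boost L U c k)).symm

/-- **Every momentum frame lies above the unpenalised sector energy**: for `0 ≤ s`,
`minEnergyOn H K ≤ minEnergyOn (H + (s/L⁴) Δ↑_d(k)ᴴΔ↑_d(k)) K`. [folklore] -/
theorem minEnergyOn_le_minEnergyOn_penalisedAt (U : ℝ) {s : ℝ} (hs : 0 ≤ s) (k : TorusSite 2 L)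
    (N : ℕ) (M : ℝ) :
    (hubbardTorus 2 L 1 U).minEnergyOn (szSector N M) ≤
      (hubbardTorus 2 L 1 U + ((s / (L : ℝ) ^ 4 : ℝ) : ℂ) • ((upPairFieldAt dWaveFormFactor L k)ᴴ *
        upPairFieldAt dWaveFormFactor L k)).minEnergyOn (szSector N M) :=
  minEnergyOn_le_minEnergyOn_add_penalty (LiebThm1.hamiltonian_isHermitian _ 1 U) _
    (by positivity) _

/-! ### Frame pinning implies the crux -/

open Summit.HubbardSuperconductivity.HubbardSuperconductivity.Theses.DeformationLadder
  Summit.HubbardSuperconductivity.HubbardSuperconductivity.Theorems.DeformationLadder in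
/-- **Frame pinning implies `LadderThesis`.** If, for some `U > 0`, `δ ∈ (0,1/2)`, `s > 0`,
`a > 0` and all large even `L`, penalising the ZERO pair-momentum mode costs at least `a·s` more
sector energy than penalising any other single mode `k ≠ 0`
(`e_L(0) - e_L(k) ≥ a s`, `e_L(k) = minEnergyOn (H_L + (s/L⁴) Δ↑_d(k)ᴴΔ↑_d(k)) (N_L, 0)`), then the
route's crux `LadderThesis` holds: every frame energy is `≥ E₀(H_L)` (positivity of the penalty), so
frame pinning at `k = e₁ ≠ 0` (`L ≥ 2`) is a uniform penalty gap `a s ≤ e_L(0) - E₀(H_L)`, which is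
`LadderThesis` by the route's normal form `ladderThesis_of_penaltyGap`.
Kaplan–Horsch–von der Linden (1989); the card `pinned-up-gauge-frame` (crux stmt-1890). [folklore] -/
theorem ladderThesis_of_framePinning
    (h : ∃ U : ℝ, 0 < U ∧ ∃ δ ∈ Set.Ioo (0:ℝ) (1 / 2), ∃ s : ℝ, 0 < s ∧ ∃ a : ℝ, 0 < a ∧ ∃ L₀ : ℕ,
      ∀ (L : ℕ) [NeZero L], L₀ ≤ L → Even L → ∀ k : TorusSite 2 L, k ≠ 0 →
        a * s ≤ (hubbardTorus 2 L 1 U + ((s / (L : ℝ) ^ 4 : ℝ) : ℂ) •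
              ((pairField dWaveFormFactor L)ᴴ * pairField dWaveFormFactor L)).minEnergyOn
              (szSector (2 * ⌊(1 - δ) * (L : ℝ) ^ 2 / 2⌋₊) 0) -
          (hubbardTorus 2 L 1 U + ((s / (L : ℝ) ^ 4 : ℝ) : ℂ) •
              ((upPairFieldAt dWaveFormFactor L k)ᴴ * upPairFieldAt dWaveFormFactor L k)).minEnergyOn
              (szSector (2 * ⌊(1 - δ) * (L : ℝ) ^ 2 / 2⌋₊) 0)) :
    LadderThesis := by
  obtain ⟨U, hU, δ, hδ, s, hs, a, ha, L₀, h⟩ := h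
  refine ladderThesis_of_penaltyGap ⟨U, hU, δ, hδ, s, hs, a, ha, max L₀ 2, fun L _ hL hev => ?_⟩
  have hL₀ : L₀ ≤ L := (le_max_left _ _).trans hL
  have hL2 : 2 ≤ L := (le_max_right _ _).trans hL
  -- the first nonzero pair momentum `k₁ = e₁`
  have hk : (Pi.single 0 1 : TorusSite 2 L) ≠ 0 := by
    haveI : Fact (1 < L) := ⟨hL2⟩
    intro h0
    have := congrFun h0 0
    rw [Pi.single_eq_same, Pi.zero_apply] at this
    exact one_ne_zero this
  have hpin := h L hL₀ hev (Pi.single 0 1) hk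
  have hfloor := minEnergyOn_le_minEnergyOn_penalisedAt L U hs.le (Pi.single 0 1)
    (2 * ⌊(1 - δ) * (L : ℝ) ^ 2 / 2⌋₊) 0
  linarith

end Summit.HubbardSuperconductivity.HubbardSuperconductivity.Theorems.PinnedFrame
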